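import Literature.MathematicalPhysics.QuantumManyBody.BoseGasEnergyRightContinuity
import HarnessLib

/-!
# Route `BECTangentRigidity`, crux `RigidMomentumBound` (stmt-AtomisticToContinuum-13034), line
# `registered`: the registered stub `stub_boxEnergyRightContinuous`

**Right-continuity of the Dirichlet ground-state energy in the box side, at fixed `N`**: for every
repulsive finite-range pair potential `v`, every `N`, every `L > 0` with `E₀(N, L) < ∞` and every
`η > 0` there is `w₀ > 0` with `E₀(N, L) ≤ E₀(N, L + w) + η` for all `0 < w < w₀` (the map
`L ↦ E₀(N, L)` is non-increasing, so the content is: no downward jump from the right). The line uses it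
to integrate Hadamard's variational formula over `L' ∈ [L_N, (1+κ/N)L_N]` (chaining lemma
`stub_slopeChain`).

The proof is the Literature theorem
`Literature.MathematicalPhysics.QuantumManyBody.BoseGas.groundStateEnergy_rightContinuous`
(`Literature/MathematicalPhysics/QuantumManyBody/BoseGasEnergyRightContinuity.lean`), valid for EVERY
pair potential `v : ℝ → [0, ∞]` (hard cores and non-measurable profiles included; the hypothesis
`IsRepulsiveFiniteRange v` of the registered signature is not used). It is variational and by
compactness, with no regularity or density theorem: near-minimisers `Φₙ` of the boxes `Λ_{L+1/(n+1)}`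
converge in `L²` and a.e. along a subsequence (Rellich–Kondrachov for trial states,
`BoseGasTrialStateCompactness.lean`, from the tree's `C¹`-core compactness theorem
`Literature.Analysis.FunctionSpaces.exists_subseq_tendsto_eLpNorm_of_contDiff`); Hardy's inequality at
the top faces (`BoseGasFaceHardy.lean`) and Fatou bound `∫ |f|²/(L - x_p)²` for the limit `f`, which
vanishes above `L`, so the collar masses of `f` below the faces of `Λ_L` are `o(h²)`; cutting `Φₙ`
down to `Λ_L` with a product cut-off (`BoseGasTopFaceCutoff.lean`) costs
`(1+α⁻¹)(π/2h)² ×` (collar mass of `Φₙ`) plus a factor `(1+α)` on the energy, the interaction entering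
only through `χ ≤ 1`, and the collar masses of `Φₙ` converge to those of `f` by STRONG `L²`
convergence — the kinetic energy that `Φₙ` may concentrate at the wall is dropped, not paid for.
Limits `n → ∞`, `h → 0`, `α → 0` give `E₀(L) ≤ supₙ E₀(L + 1/(n+1))`, whence the claim by
antitonicity.
-/

noncomputable section

namespace Summit.AtomisticToContinuum.BoseEinsteinCondensation.Theorems.RigidMomentumBound

open MeasureTheory Filter Set
open scoped ENNReal NNReal
open Literature.MathematicalPhysics.QuantumManyBody.BoseGas

/-- **`stub_boxEnergyRightContinuous`** (registered stub of line `registered`, crux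
`RigidMomentumBound`): fixed-`N` right-continuity of the Dirichlet ground-state energy in the box
side — for every repulsive finite-range `v`, `N`, `L > 0` with `E₀(N, L) ≠ ⊤` and `η > 0` there is
`w₀ > 0` such that `E₀(N, L) ≤ E₀(N, L + w) + η` for all `0 < w < w₀`. Immediate from the Literature
theorem `groundStateEnergy_rightContinuous` (which holds for every `v : ℝ → [0, ∞]`). -/
theorem stub_boxEnergyRightContinuous :
    ∀ (v : ℝ → ℝ≥0∞), IsRepulsiveFiniteRange v → ∀ (N : ℕ) (L : ℝ), 0 < L →
      groundStateEnergy v N L ≠ ⊤ → ∀ η : ℝ, 0 < η → ∃ w₀ : ℝ, 0 < w₀ ∧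
        ∀ w : ℝ, 0 < w → w < w₀ →
          groundStateEnergy v N L ≤ groundStateEnergy v N (L + w) + ENNReal.ofReal η :=
  fun v _ N _ hL hfin _ hη => groundStateEnergy_rightContinuous v N hL hfin hη

end Summit.AtomisticToContinuum.BoseEinsteinCondensation.Theorems.RigidMomentumBound

end
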